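import Literature.AnabelianGeometry.SemiGraphs.TemperedReconstructionBaseUniquenessProofs
import Literature.AnabelianGeometry.SemiGraphs.TemperedReconstructionEdgeVertexProofs
import HarnessLib

/-!
# [SemiAnbd] Cor. 3.9: the underlying map of graphs is FUNCTORIAL in `φ` (proof-only)

Mochizuki, *Semi-graphs of anabelioids*, Publ. RIMS **42** (2006), §3, proof of Cor. 3.9, p. 268
top: "Thus, in summary, we conclude that a quasi-geometric `φ : B^temp(G) → B^temp(H)` determines a
map on the underlying graphs `G → H` that is functorial in `φ`" [cite: MochizukiSemiAnbd2006, Cor 3.9 pp.42-43].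

In the tree's local presentation (`ProfiniteSemiGraph.Hom`, charts `TemperedPiChart`, compatibility
`Hom.CompatV` on verticial homomorphisms) this is `base_comp_of_compatV`: if locally open
`F₁ : G → H`, `F₂ : H → K`, `F : G → K` are compatible on verticial homomorphisms with `φ₁`, `φ₂` and
`φ₂ ∘ φ₁` respectively, then `F.base = F₁.base ≫ F₂.base` — UNCONDITIONALLY (Thm. 3.7 (i), (ii) are
theorems of the tree; no (iii), no `CompatE`).  Route: the host of `φ₂φ₁(ψ_v(Π_v))` is read two ways
(through `F`, and through `F₂ ∘ F₁` with the composite vertex homomorphism, whose image is open),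
the hosts coincide by finite index + Thm. 3.7 (ii) (`host_eq_of_conj`), giving the vertex map; the
branch maps follow from the composite 2-cell and total estrangement (t11 `branch_eq_of_hosts_eq`),
and the edge map from the branch maps.  Also recorded: `isOpen_range_comp` (composites of
open-image homomorphisms of profinite groups have open image), the abstract two-cell lemma
`map_branchSubgroup_le_of_twoCell`, and `compatV_comp` (the composite vertex homomorphisms are
compatible with `φ₂ ∘ φ₁`).

Nothing here takes a side on [IUTchIII] Cor. 3.12; typed ≠ discharged.
-/

namespace Literature.AnabelianGeometry.SemiGraphs

namespace ProfiniteSemiGraph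

universe u

variable {𝒢 ℋ 𝒦 : ProfiniteSemiGraph.{u}}

/-! ### Group-theoretic preliminaries -/

/-- The composite of two continuous homomorphisms of compact groups with open images has open image
(finite index is multiplicative; a compact subgroup of finite index is open). [folklore] -/
private theorem isOpen_range_comp {A B C : Type*} [Group A] [TopologicalSpace A] [IsTopologicalGroup A]
    [CompactSpace A] [Group B] [TopologicalSpace B] [IsTopologicalGroup B] [CompactSpace B]
    [Group C] [TopologicalSpace C] [IsTopologicalGroup C] [CompactSpace C] [T2Space C]
    (f : A →ₜ* B) (g : B →ₜ* C) (hf : IsOpen (f.toMonoidHom.range : Set B))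
    (hg : IsOpen (g.toMonoidHom.range : Set C)) :
    IsOpen ((g.comp f).toMonoidHom.range : Set C) := by
  have hfg : (g.comp f).toMonoidHom.range = f.toMonoidHom.range.map g.toMonoidHom :=
    (MonoidHom.map_range g.toMonoidHom f.toMonoidHom).symm
  -- finite index
  have h1 : f.toMonoidHom.range.index ≠ 0 := by
    haveI := Subgroup.quotient_finite_of_isOpen _ hf
    exact Subgroup.index_ne_zero_of_finite
  have h2 : g.toMonoidHom.range.index ≠ 0 := by
    haveI := Subgroup.quotient_finite_of_isOpen _ hg
    exact Subgroup.index_ne_zero_of_finite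
  have h3 : (f.toMonoidHom.range ⊔ g.toMonoidHom.ker).index ≠ 0 := fun h0 =>
    h1 (Nat.eq_zero_of_zero_dvd (h0 ▸ Subgroup.index_dvd_of_le le_sup_left))
  have hidx : (g.comp f).toMonoidHom.range.index ≠ 0 := by
    rw [hfg, Subgroup.index_map]
    exact mul_ne_zero h3 h2
  haveI : (g.comp f).toMonoidHom.range.FiniteIndex := Subgroup.finiteIndex_iff.mpr hidx
  -- closed (image of a compact group)
  have hcl : IsClosed ((g.comp f).toMonoidHom.range : Set C) := by
    have : ((g.comp f).toMonoidHom.range : Set C) = Set.range (g.comp f) := rfl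
    rw [this]
    exact (isCompact_range (g.comp f).continuous).isClosed
  exact Subgroup.isOpen_of_isClosed_of_finiteIndex _ hcl

/-- The transported edge homomorphism `F.hEAt` of a locally open `F` has open image.
[cite: MochizukiSemiAnbd2006, Def 2.2(ii) p.24] -/
theorem Hom.isOpen_range_hEAt (F : Hom 𝒢 ℋ) (hF : F.IsLocallyOpen) (e : 𝒢.graph.Edge)
    (f : ℋ.graph.Edge) (p : F.base.edgeMap e = f) :
    IsOpen ((F.hEAt e f p).toMonoidHom.range : Set (ℋ.Ge f)) := by
  subst p
  exact hF.2 e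

/-- **The 2-cell of `F` at a branch, in `brHom` form**: for a branch `b` at `v` there is `g ∈ Π_{F v}`
with `g · (F b)_*(F_e(z)) · g⁻¹ = F_v(b_*(z))`, the edge homomorphism being transported along
`F (edgeOf b) = edgeOf (F b)`. [cite: MochizukiSemiAnbd2006, Rmk 2.4.2 p.26] -/
theorem Hom.exists_twoCell (F : Hom 𝒢 ℋ) {b : 𝒢.graph.Branch} {v : 𝒢.graph.Vertex}
    (hv : 𝒢.graph.abuts b = some v) :
    ∃ g : ℋ.Gv (F.base.vertexMap v), ∀ z,
      g * ℋ.brHom (F.base.branchMap b) (F.base.vertexMap v) (F.base.abuts_branchMap b v hv)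
        (F.hEAt (𝒢.graph.edgeOf b) _ (F.base.edgeOf_branchMap b).symm z) * g⁻¹ =
        F.hV v (𝒢.brHom b v hv z) :=
  F.exists_conj b v hv _ (F.base.edgeOf_branchMap b).symm rfl

/-! ### Hosts and branches for an abstract compatible pair -/

/-- **Finite index in the host.**  If `φ ∘ ψ = γ_c ∘ Ψ ∘ η` with `η : Π_v → Π_w` of open image and `Ψ`
a verticial homomorphism at `w`, then `φ(ψ(Π_v))` has finite index in the host `c · Ψ(Π_w) · c⁻¹`.
[cite: MochizukiSemiAnbd2006, Cor 3.9 pp.42-43] -/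
theorem relIndex_map_range_ne_zero_of_conj (hℋ : Cor39Hypotheses ℋ) (cℋ : TemperedPiChart ℋ)
    {P : Type u} [Group P] (φ : P →* cℋ.G) {v : 𝒢.graph.Vertex} (ψ : 𝒢.Gv v →* P)
    {w : ℋ.graph.Vertex} (η : 𝒢.Gv v →* ℋ.Gv w) (hη : IsOpen (η.range : Set (ℋ.Gv w)))
    (Ψ : ℋ.Gv w →ₜ* cℋ.G) (hΨ : IsVerticialHom cℋ w Ψ) (c : cℋ.G)
    (hc : ∀ y, φ (ψ y) = c * Ψ (η y) * c⁻¹) :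
    (ψ.range.map φ).relIndex (Ψ.toMonoidHom.range.map (MulAut.conj c).toMonoidHom) ≠ 0 := by
  have hℋ37 := hℋ.thm37Hypotheses
  let j : ℋ.Gv w →* cℋ.G := (MulAut.conj c).toMonoidHom.comp Ψ.toMonoidHom
  have hj : Function.Injective j := fun a₁ a₂ h =>
    (verticialInjective_holds ℋ hℋ37 cℋ _).2 Ψ hΨ ((MulAut.conj c).injective h)
  have hS : ψ.range.map φ = η.range.map j := by
    ext y
    constructor
    · rintro ⟨_, ⟨x, rfl⟩, rfl⟩
      exact ⟨η x, ⟨x, rfl⟩, (hc x).symm⟩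
    · rintro ⟨_, ⟨x, rfl⟩, rfl⟩
      exact ⟨ψ x, ⟨x, rfl⟩, hc x⟩
  have hW : Ψ.toMonoidHom.range.map (MulAut.conj c).toMonoidHom = (⊤ : Subgroup (ℋ.Gv w)).map j := by
    rw [MonoidHom.range_eq_map, Subgroup.map_map]
  have hU : η.range.index ≠ 0 := by
    haveI := Subgroup.quotient_finite_of_isOpen _ hη
    exact Subgroup.index_ne_zero_of_finite
  rw [hS, hW, Subgroup.relIndex_map_map_of_injective _ _ hj, Subgroup.relIndex_top_right]
  exact hU

/-- **Hosts coincide.**  Two readings `φ ∘ ψ = γ_c ∘ Ψ ∘ η = γ_{c'} ∘ Ψ' ∘ η'` of the same `φ ∘ ψ`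
through verticial homomorphisms `Ψ` (at `w`) and `Ψ'` (at `w'`), the first with `η` of open image,
have the same host `c · Ψ(Π_w) · c⁻¹ = c' · Ψ'(Π_{w'}) · c'⁻¹` (finite index + Thm. 3.7 (ii)) — hence
`w = w'`. [cite: MochizukiSemiAnbd2006, Cor 3.9 pp.42-43] -/
theorem host_eq_of_conj (hℋ : Cor39Hypotheses ℋ) (cℋ : TemperedPiChart ℋ) {P : Type u} [Group P]
    (φ : P →* cℋ.G) {v : 𝒢.graph.Vertex} (ψ : 𝒢.Gv v →* P) {w w' : ℋ.graph.Vertex}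
    (η : 𝒢.Gv v →* ℋ.Gv w) (hη : IsOpen (η.range : Set (ℋ.Gv w))) (Ψ : ℋ.Gv w →ₜ* cℋ.G)
    (hΨ : IsVerticialHom cℋ w Ψ) (c : cℋ.G) (hc : ∀ y, φ (ψ y) = c * Ψ (η y) * c⁻¹)
    (η' : 𝒢.Gv v →* ℋ.Gv w') (Ψ' : ℋ.Gv w' →ₜ* cℋ.G) (hΨ' : IsVerticialHom cℋ w' Ψ') (c' : cℋ.G)
    (hc' : ∀ y, φ (ψ y) = c' * Ψ' (η' y) * c'⁻¹) :
    Ψ.toMonoidHom.range.map (MulAut.conj c).toMonoidHom =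
        Ψ'.toMonoidHom.range.map (MulAut.conj c').toMonoidHom ∧ w = w' := by
  have hℋ37 := hℋ.thm37Hypotheses
  have hW : Ψ.toMonoidHom.range.map (MulAut.conj c).toMonoidHom ∈ verticialSubgroups cℋ w :=
    conj_mem_verticialSubgroups cℋ (range_mem_verticialSubgroups cℋ Ψ hΨ) c
  have hW' : Ψ'.toMonoidHom.range.map (MulAut.conj c').toMonoidHom ∈ verticialSubgroups cℋ w' :=
    conj_mem_verticialSubgroups cℋ (range_mem_verticialSubgroups cℋ Ψ' hΨ') c'
  have hS := relIndex_map_range_ne_zero_of_conj hℋ cℋ φ ψ η hη Ψ hΨ c hc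
  have hS' : ψ.range.map φ ≤ Ψ'.toMonoidHom.range.map (MulAut.conj c').toMonoidHom := by
    rintro _ ⟨_, ⟨x, rfl⟩, rfl⟩
    exact ⟨Ψ' (η' x), ⟨η' x, rfl⟩, (hc' x).symm⟩
  have hrel : (Ψ'.toMonoidHom.range.map (MulAut.conj c').toMonoidHom).relIndex
      (Ψ.toMonoidHom.range.map (MulAut.conj c).toMonoidHom) ≠ 0 :=
    fun h0 => hS (Subgroup.relIndex_eq_zero_of_le_left hS' h0)
  have hEq := eq_of_relIndex_ne_zero_of_mem_verticialSubgroups verticialDistinct_holds hℋ37 cℋ hW hW' hrel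
  exact ⟨hEq, vertex_eq_of_mem_verticialSubgroups hℋ37 cℋ hW (hEq ▸ hW')⟩

/-- **The abstract 2-cell lemma.**  If `φ ∘ ψ = γ_c ∘ Ψ ∘ η` on `Π_v` and `η ∘ b_* = γ_γ ∘ b'_* ∘ η_E`
for a branch `b` at `v`, a branch `b'` at `w`, `η_E : Π_e → Π_{e'}` of open image and `γ ∈ Π_w`, then
`φ(ψ(Π_b))` is a NONTRIVIAL subgroup of the branch subgroup of `b'` in the host
`(c Ψ(γ)) · Ψ(Π_w) · (c Ψ(γ))⁻¹ = c · Ψ(Π_w) · c⁻¹`. [cite: MochizukiSemiAnbd2006, Cor 3.9 pp.42-43] -/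
theorem map_branchSubgroup_le_of_twoCell (hℋ : Cor39Hypotheses ℋ) (cℋ : TemperedPiChart ℋ)
    {P : Type u} [Group P] (φ : P →* cℋ.G) {b : 𝒢.graph.Branch} {v : 𝒢.graph.Vertex}
    (hv : 𝒢.graph.abuts b = some v) (ψ : 𝒢.Gv v →* P) {b' : ℋ.graph.Branch} {w : ℋ.graph.Vertex}
    (hw : ℋ.graph.abuts b' = some w) (η : 𝒢.Gv v →* ℋ.Gv w)
    (ηE : 𝒢.Ge (𝒢.graph.edgeOf b) →ₜ* ℋ.Ge (ℋ.graph.edgeOf b'))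
    (hηE : IsOpen (ηE.toMonoidHom.range : Set (ℋ.Ge (ℋ.graph.edgeOf b')))) (γ : ℋ.Gv w)
    (hγ : ∀ z, γ * ℋ.brHom b' w hw (ηE z) * γ⁻¹ = η (𝒢.brHom b v hv z))
    (Ψ : ℋ.Gv w →ₜ* cℋ.G) (hΨ : IsVerticialHom cℋ w Ψ) (c : cℋ.G)
    (hc : ∀ y, φ (ψ y) = c * Ψ (η y) * c⁻¹) :
    Ψ.toMonoidHom.range.map (MulAut.conj (c * Ψ γ)).toMonoidHom =
        Ψ.toMonoidHom.range.map (MulAut.conj c).toMonoidHom ∧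
      ((𝒢.branchSubgroup b v hv).map ψ).map φ ≤
        ((ℋ.branchSubgroup b' w hw).map Ψ.toMonoidHom).map (MulAut.conj (c * Ψ γ)).toMonoidHom ∧
      ((𝒢.branchSubgroup b v hv).map ψ).map φ ≠ ⊥ := by
  have hℋ37 := hℋ.thm37Hypotheses
  refine ⟨?_, ?_, ?_⟩
  · apply le_antisymm
    · rintro _ ⟨_, ⟨y, rfl⟩, rfl⟩
      refine ⟨Ψ (γ * y * γ⁻¹), ⟨_, rfl⟩, ?_⟩
      show c * Ψ (γ * y * γ⁻¹) * c⁻¹ = c * Ψ γ * Ψ y * (c * Ψ γ)⁻¹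
      rw [map_mul Ψ, map_mul Ψ, map_inv Ψ]
      group
    · rintro _ ⟨_, ⟨y, rfl⟩, rfl⟩
      refine ⟨Ψ (γ⁻¹ * y * γ), ⟨_, rfl⟩, ?_⟩
      show c * Ψ γ * Ψ (γ⁻¹ * y * γ) * (c * Ψ γ)⁻¹ = c * Ψ y * c⁻¹
      rw [map_mul Ψ, map_mul Ψ, map_inv Ψ]
      group
  · rintro _ ⟨_, ⟨_, ⟨z, rfl⟩, rfl⟩, rfl⟩
    refine ⟨Ψ (ℋ.brHom b' w hw (ηE z)), ⟨_, ⟨ηE z, rfl⟩, rfl⟩, ?_⟩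
    show c * Ψ γ * Ψ (ℋ.brHom b' w hw (ηE z)) * (c * Ψ γ)⁻¹ = φ (ψ (𝒢.brHom b v hv z))
    rw [hc, ← hγ z, map_mul Ψ, map_mul Ψ, map_inv Ψ]
    group
  · intro h0
    apply ne_bot_of_isOpen_ge hℋ37.toProp36Hypotheses hw hηE
    rw [eq_bot_iff]
    rintro _ ⟨z, rfl⟩
    have hz : φ (ψ (𝒢.brHom b v hv z)) ∈ ((𝒢.branchSubgroup b v hv).map ψ).map φ :=
      ⟨_, ⟨_, ⟨z, rfl⟩, rfl⟩, rfl⟩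
    rw [h0, Subgroup.mem_bot, hc, ← hγ z, mul_inv_eq_one, mul_eq_left, map_mul Ψ, map_mul Ψ,
      map_inv Ψ, mul_inv_eq_one, mul_eq_left] at hz
    have h2 := (verticialInjective_holds ℋ hℋ37 cℋ _).2 Ψ hΨ (by rw [hz, map_one] : Ψ _ = Ψ 1)
    exact hℋ.isOfInjectiveType b' w hw
      (by change ℋ.brHom b' w hw (ηE z) = _; rw [h2, map_one])

/-! ### Functoriality -/

/-- **The composite vertex homomorphisms are compatible with `φ₂ ∘ φ₁`**: from `CompatV` for
`(F₁, φ₁)` and `(F₂, φ₂)`, `φ₂(φ₁(ψ y)) = m · Ξ(F₂,_{F₁ v}(F₁,ᵥ(y))) · m⁻¹` with `m = φ₂(c₁) c₂`.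
[cite: MochizukiSemiAnbd2006, Prop 3.6(iv) p.39] -/
theorem compatV_comp (c𝒢 : TemperedPiChart 𝒢) (cℋ : TemperedPiChart ℋ) (c𝒦 : TemperedPiChart 𝒦)
    (F₁ : Hom 𝒢 ℋ) (F₂ : Hom ℋ 𝒦) (φ₁ : c𝒢.G →ₜ* cℋ.G) (φ₂ : cℋ.G →ₜ* c𝒦.G)
    (hV₁ : F₁.CompatV c𝒢 cℋ φ₁) (hV₂ : F₂.CompatV cℋ c𝒦 φ₂) (v : 𝒢.graph.Vertex)
    (ψ : 𝒢.Gv v →ₜ* c𝒢.G) (Ψ : ℋ.Gv (F₁.base.vertexMap v) →ₜ* cℋ.G)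
    (Ξ : 𝒦.Gv (F₂.base.vertexMap (F₁.base.vertexMap v)) →ₜ* c𝒦.G) (hψ : IsVerticialHom c𝒢 v ψ)
    (hΨ : IsVerticialHom cℋ _ Ψ) (hΞ : IsVerticialHom c𝒦 _ Ξ) :
    ∃ m : c𝒦.G, ∀ y, φ₂ (φ₁ (ψ y)) = m * Ξ (F₂.hV _ (F₁.hV v y)) * m⁻¹ := by
  obtain ⟨c₁, hc₁⟩ := hV₁ v ψ Ψ hψ hΨ
  obtain ⟨c₂, hc₂⟩ := hV₂ _ Ψ Ξ hΨ hΞ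
  refine ⟨φ₂ c₁ * c₂, fun y => ?_⟩
  rw [hc₁, map_mul φ₂, map_mul φ₂, map_inv φ₂, hc₂]
  group

/-- **[SemiAnbd] Cor. 3.9: the underlying map of graphs is functorial in `φ`** (p. 268): for locally
open `F₁ : G → H`, `F₂ : H → K`, `F : G → K` compatible on verticial homomorphisms with `φ₁`, `φ₂`
and `φ₂ ∘ φ₁` respectively (`G` a graph, all three as in Cor. 3.9), the underlying morphism of
semi-graphs of `F` is the composite of those of `F₁` and `F₂` — UNCONDITIONAL.
[cite: MochizukiSemiAnbd2006, Cor 3.9 pp.42-43] -/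
theorem base_comp_of_compatV (h𝒢 : Cor39Hypotheses 𝒢) (hℋ : Cor39Hypotheses ℋ)
    (h𝒦 : Cor39Hypotheses 𝒦) (c𝒢 : TemperedPiChart 𝒢) (cℋ : TemperedPiChart ℋ)
    (c𝒦 : TemperedPiChart 𝒦) {F₁ : Hom 𝒢 ℋ} {F₂ : Hom ℋ 𝒦} {F : Hom 𝒢 𝒦}
    {φ₁ : c𝒢.G →ₜ* cℋ.G} {φ₂ : cℋ.G →ₜ* c𝒦.G} (hF₁ : F₁.IsLocallyOpen) (hF₂ : F₂.IsLocallyOpen)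
    (hF : F.IsLocallyOpen) (hV₁ : F₁.CompatV c𝒢 cℋ φ₁) (hV₂ : F₂.CompatV cℋ c𝒦 φ₂)
    (hV : F.CompatV c𝒢 c𝒦 (φ₂.comp φ₁)) : F.base = F₁.base.comp F₂.base := by
  classical
  have h𝒢37 := h𝒢.thm37Hypotheses
  have hℋ37 := hℋ.thm37Hypotheses
  have h𝒦37 := h𝒦.thm37Hypotheses
  choose ψ hψ using exists_isVerticialHom_of_thm37i verticialInjective_holds h𝒢37 c𝒢
  choose Ψ hΨ using exists_isVerticialHom_of_thm37i verticialInjective_holds hℋ37 cℋ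
  choose Ξ hΞ using exists_isVerticialHom_of_thm37i verticialInjective_holds h𝒦37 c𝒦
  -- the two readings of `φ₂φ₁ ∘ ψ_v`, at every vertex
  have hcomp : ∀ v, ∃ m : c𝒦.G, ∀ y,
      (φ₂.comp φ₁).toMonoidHom ((ψ v).toMonoidHom y) =
        m * Ξ _ (((F₂.hV _).toMonoidHom.comp (F₁.hV v).toMonoidHom) y) * m⁻¹ := fun v =>
    compatV_comp c𝒢 cℋ c𝒦 F₁ F₂ φ₁ φ₂ hV₁ hV₂ v (ψ v) (Ψ _) (Ξ _) (hψ v) (hΨ _) (hΞ _)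
  have hown : ∀ v, ∃ c : c𝒦.G, ∀ y,
      (φ₂.comp φ₁).toMonoidHom ((ψ v).toMonoidHom y) = c * Ξ _ ((F.hV v).toMonoidHom y) * c⁻¹ :=
    fun v => hV v (ψ v) (Ξ _) (hψ v) (hΞ _)
  have hopen : ∀ v, IsOpen ((((F₂.hV _).toMonoidHom.comp (F₁.hV v).toMonoidHom).range :
      Set (𝒦.Gv (F₂.base.vertexMap (F₁.base.vertexMap v))))) := fun v =>
    isOpen_range_comp (F₁.hV v) (F₂.hV _) (hF₁.1 v) (hF₂.1 _)
  refine SemiGraph.Hom.ext_of_branchMap ?_ ?_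
  · -- vertices
    funext v
    obtain ⟨m, hm⟩ := hcomp v
    obtain ⟨c, hc⟩ := hown v
    exact ((host_eq_of_conj h𝒦 c𝒦 (φ₂.comp φ₁).toMonoidHom (ψ v).toMonoidHom _ (hopen v) (Ξ _)
      (hΞ _) m hm (F.hV v).toMonoidHom (Ξ _) (hΞ _) c hc).2).symm
  · -- branches
    funext b
    obtain ⟨v, hv⟩ := Option.isSome_iff_exists.mp (h𝒢.isGraph.abuts_isSome b)
    obtain ⟨m, hm⟩ := hcomp v
    obtain ⟨c, hc⟩ := hown v
    -- the composite 2-cell at `b`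
    obtain ⟨g₁, hg₁⟩ := F₁.exists_twoCell hv
    obtain ⟨g₂, hg₂⟩ := F₂.exists_twoCell (F₁.base.abuts_branchMap b v hv)
    have hγ : ∀ z, (F₂.hV _ g₁ * g₂) *
        𝒦.brHom (F₂.base.branchMap (F₁.base.branchMap b)) _
          (F₂.base.abuts_branchMap _ _ (F₁.base.abuts_branchMap b v hv))
          (((F₂.hEAt _ _ (F₂.base.edgeOf_branchMap (F₁.base.branchMap b)).symm).comp
            (F₁.hEAt _ _ (F₁.base.edgeOf_branchMap b).symm)) z) * (F₂.hV _ g₁ * g₂)⁻¹ =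
        ((F₂.hV _).toMonoidHom.comp (F₁.hV v).toMonoidHom) (𝒢.brHom b v hv z) := by
      intro z
      change F₂.hV _ g₁ * g₂ * 𝒦.brHom _ _ _ (F₂.hEAt _ _ _ (F₁.hEAt _ _ _ z)) * (F₂.hV _ g₁ * g₂)⁻¹ =
        F₂.hV _ (F₁.hV v (𝒢.brHom b v hv z))
      rw [← hg₁ z, map_mul (F₂.hV _), map_mul (F₂.hV _), map_inv (F₂.hV _), ← hg₂]
      group
    have hηE := isOpen_range_comp (F₁.hEAt _ _ (F₁.base.edgeOf_branchMap b).symm)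
      (F₂.hEAt _ _ (F₂.base.edgeOf_branchMap (F₁.base.branchMap b)).symm)
      (F₁.isOpen_range_hEAt hF₁ _ _ _) (F₂.isOpen_range_hEAt hF₂ _ _ _)
    obtain ⟨hhost₁₂, hle₁₂, hne⟩ := map_branchSubgroup_le_of_twoCell h𝒦 c𝒦 (φ₂.comp φ₁).toMonoidHom
      hv (ψ v).toMonoidHom _ _ _ hηE _ hγ (Ξ _) (hΞ _) m hm
    -- the 2-cell of `F` at `b`
    obtain ⟨g, hg⟩ := F.exists_twoCell hv
    obtain ⟨hhost, hle, -⟩ := map_branchSubgroup_le_of_twoCell h𝒦 c𝒦 (φ₂.comp φ₁).toMonoidHom hv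
      (ψ v).toMonoidHom (F.base.abuts_branchMap b v hv) (F.hV v).toMonoidHom _
      (F.isOpen_range_hEAt hF _ _ _) g hg (Ξ _) (hΞ _) c hc
    -- hosts coincide; total estrangement
    have hW := (host_eq_of_conj h𝒦 c𝒦 (φ₂.comp φ₁).toMonoidHom (ψ v).toMonoidHom _ (hopen v) (Ξ _)
      (hΞ _) m hm (F.hV v).toMonoidHom (Ξ _) (hΞ _) c hc).1
    rw [← hhost₁₂, ← hhost] at hW
    exact (branch_eq_of_hosts_eq verticialDistinct_holds verticialInjective_holds h𝒦37 c𝒦 Ξ hΞ hne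
      (F₂.base.abuts_branchMap _ _ (F₁.base.abuts_branchMap b v hv)) (F.base.abuts_branchMap b v hv)
      _ _ hle₁₂ hle hW).symm

end ProfiniteSemiGraph

end Literature.AnabelianGeometry.SemiGraphs
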